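import Literature.NumberTheory.GaloisRepresentations.GaloisCohomologyLayerInflationTransitive
import Literature.NumberTheory.GaloisRepresentations.GaloisCohomologyLayerInflationUnion
import Mathlib.FieldTheory.Galois.GaloisClosure
import HarnessLib

/-!
# Every class of `H¹(K, M)`, `H²(K, M)` (finite `M`) comes from a finite Galois layer that SPLITS `M`
# (Serre, *Galois Cohomology* I §2.2 Cor. 1 with `U` inside the kernel of the action)

Topic `NumberTheory/GaloisRepresentations`; namespace `Literature.NumberTheory.GaloisRepresentations`.
Proof file: theorems only (no definition, no named fact, no instance, no notation; D-0026).  Sequel to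
`GaloisCohomologyLayerInflationUnion` (`exists_infTwo_eq`), `GaloisCohomologyLayerInflationCup`
(`exists_infOneLayer_eq`) and `GaloisCohomologyLayerInflationTransitive` (`range_infTwo_mono`,
`range_infOneLayer_mono`: the images of the layer inflations grow along `E ≤ E'`).

For a field `K : Type` and a FINITE discrete `Γ_K`-module `M`:
* `exists_isGalois_forall_apply_eq` — a finite Galois `E_M ⊆ K̄` with `Γ_{E_M}` acting trivially on `M`
  (the kernel of the action is an open neighbourhood of `1`; `exists_finiteDimensional_isGalois_of_mem_nhds_one`);
* `layerInvariants_eq_top_of_forall_apply_eq` — for such a layer the layer module is ALL of `M`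
  (`M^{Γ_E} = ⊤`);
* **`exists_infOneLayer_eq_of_split`**, **`exists_infTwo_eq_of_split`** — every class of `H¹(K, M)` /
  `H²(K, M)` is inflated from a finite Galois layer `E` with `Γ_E` acting trivially on `M` (enlarge the
  layer of `exists_infOneLayer_eq` / `exists_infTwo_eq` to `E ⊔ E_M`; the images grow along the system).

These are the layers the Poitou–Tate assembly works at (Milne I Thm. 1.8 proof: "`U` an open normal
subgroup of `G` such that `M^U = M`"; Lemma 4.13: "limit over `F` … splitting `M`").  HONEST FRAMING:
homological algebra only.

## References
* J.-P. Serre, *Galois Cohomology* (1997), Ch. I §2.2 Prop. 8 and Cor. 1. [SerreGaloisCohomology1997]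
* J. S. Milne, *Arithmetic Duality Theorems*, 2nd ed. (2006), Ch. I, proof of Thm. 1.8 and Lemma 4.13.
  [MilneADT2006]
-/

noncomputable section

open CategoryTheory groupCohomology Field Function
open scoped Topology

namespace Literature.NumberTheory.GaloisRepresentations

open LocalWeilDatum

variable (K : Type) [Field K]
variable {M : Type} [AddCommGroup M] [TopologicalSpace M] [DiscreteTopology M] (ρ : DiscreteGaloisModule K M)

/-- **A finite Galois layer splitting a finite module**: for finite `M` there is a finite Galois `E ⊆ K̄`
with `Gal(K̄/E)` acting trivially on `M`. [cite: SerreGaloisCohomology1997, I §2.2 (stabilisers are open)] -/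
theorem exists_isGalois_forall_apply_eq [Finite M] :
    ∃ (E : IntermediateField K (AlgebraicClosure K)) (_ : FiniteDimensional K E) (_ : IsGalois K E),
      ∀ σ ∈ absGaloisFixingSubgroup E, ∀ m : M, ρ σ m = m := by
  have hU : (⋂ a : M, {g : absoluteGaloisGroup K | ρ g a = a}) ∈ 𝓝 (1 : absoluteGaloisGroup K) :=
    (Filter.iInter_mem).2 fun a => ρ.setOf_apply_eq_mem_nhds_one a
  obtain ⟨E, hfd, hgal, hE⟩ := exists_finiteDimensional_isGalois_of_mem_nhds_one K hU
  haveI := hfd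
  haveI := hgal
  exact ⟨E, hfd, hgal, fun σ hσ m =>
    Set.mem_iInter.1 (hE σ ((mem_absGaloisFixingSubgroup_iff E σ).1 hσ)) m⟩

/-- Triviality of the action passes to bigger layers. [cite: SerreGaloisCohomology1997, I §2.2] -/
theorem forall_apply_eq_of_le {E E' : IntermediateField K (AlgebraicClosure K)} [Normal K E] [Normal K E']
    (h : E ≤ E') (hE : ∀ σ ∈ absGaloisFixingSubgroup E, ∀ m : M, ρ σ m = m) :
    ∀ σ ∈ absGaloisFixingSubgroup E', ∀ m : M, ρ σ m = m := fun σ hσ m =>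
  hE σ (absGaloisFixingSubgroup_antitone K E E' h hσ) m

/-- **For a splitting layer the layer module is all of `M`**: `M^{Γ_E} = ⊤`.
[cite: MilneADT2006, Ch. I, proof of Thm. 1.8 ("`M^U = M`")] -/
theorem layerInvariants_eq_top_of_forall_apply_eq (E : IntermediateField K (AlgebraicClosure K)) [Normal K E]
    (hE : ∀ σ ∈ absGaloisFixingSubgroup E, ∀ m : M, ρ σ m = m) :
    Representation.invariants (ρ.toRepresentation.comp (absGaloisFixingSubgroup E).subtype) = ⊤ :=
  eq_top_iff.2 fun m _ s => hE s s.2 m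

/-- **Every class of `H¹(K, M)` (finite `M`) is inflated from a finite Galois layer splitting `M`.**
[cite: SerreGaloisCohomology1997, I §2.2 Cor. 1 to Prop. 8][cite: MilneADT2006, Ch. I, proof of Thm. 1.8] -/
theorem exists_infOneLayer_eq_of_split [Finite M] (x : galoisCohomology ρ 1) :
    ∃ (E : IntermediateField K (AlgebraicClosure K)) (_ : FiniteDimensional K E) (_ : IsGalois K E),
      (∀ σ ∈ absGaloisFixingSubgroup E, ∀ m : M, ρ σ m = m) ∧
        ∃ y : groupCohomology (absGaloisLayerRep K E ρ) 1, infOneLayer K E ρ y = x := by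
  obtain ⟨E₁, h₁fd, h₁gal, y₁, hy₁⟩ := exists_infOneLayer_eq K ρ x
  obtain ⟨E₂, h₂fd, h₂gal, hE₂⟩ := exists_isGalois_forall_apply_eq K ρ
  haveI := h₁fd; haveI := h₁gal; haveI := h₂fd; haveI := h₂gal
  haveI : IsGalois K (E₁ ⊔ E₂ : IntermediateField K (AlgebraicClosure K)) := inferInstance
  obtain ⟨y, hy⟩ := range_infOneLayer_mono K E₁ (E₁ ⊔ E₂) ρ le_sup_left ⟨y₁, hy₁⟩
  exact ⟨E₁ ⊔ E₂, inferInstance, inferInstance, forall_apply_eq_of_le K ρ le_sup_right hE₂, y, hy⟩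

/-- **Every class of `H²(K, M)` (finite `M`) is inflated from a finite Galois layer splitting `M`.**
[cite: SerreGaloisCohomology1997, I §2.2 Cor. 1 to Prop. 8][cite: MilneADT2006, Ch. I, Lemma 4.13 (proof)] -/
theorem exists_infTwo_eq_of_split [Finite M] (x : galoisCohomology ρ 2) :
    ∃ (E : IntermediateField K (AlgebraicClosure K)) (_ : FiniteDimensional K E) (_ : IsGalois K E),
      (∀ σ ∈ absGaloisFixingSubgroup E, ∀ m : M, ρ σ m = m) ∧
        ∃ y : groupCohomology (absGaloisLayerRep K E ρ) 2, infTwo K E ρ y = x := by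
  obtain ⟨E₁, h₁fd, h₁gal, y₁, hy₁⟩ := exists_infTwo_eq K ρ x
  obtain ⟨E₂, h₂fd, h₂gal, hE₂⟩ := exists_isGalois_forall_apply_eq K ρ
  haveI := h₁fd; haveI := h₁gal; haveI := h₂fd; haveI := h₂gal
  haveI : IsGalois K (E₁ ⊔ E₂ : IntermediateField K (AlgebraicClosure K)) := inferInstance
  obtain ⟨y, hy⟩ := range_infTwo_mono K E₁ (E₁ ⊔ E₂) ρ le_sup_left ⟨y₁, hy₁⟩
  exact ⟨E₁ ⊔ E₂, inferInstance, inferInstance, forall_apply_eq_of_le K ρ le_sup_right hE₂, y, hy⟩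

end Literature.NumberTheory.GaloisRepresentations

end
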